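import Summits.QuantumFields.BalabanUV.Beta.SymBorderWardSiteLaw
import Summits.QuantumFields.BalabanUV.Beta.SymWardLettersUnpacking
import Summits.QuantumFields.BalabanUV.Beta.DiagonalContact

/-!
# `BalabanUV.Beta.D1BFx.CombBorderPairSlotLetter` — road «BF-x», binder row D1, PART 24 HEAD (H2-letters), commission C-g24-1 (OWNER fallback):
# **THE RECORD's SECOND-ORDER BORDER TABLE OBEYS THE POINTWISE SLOT WARD LETTERS OF TT12 ∕ TT15** — for an1's symmetrised border bi-table
# `symVh₂SAn1 3 Lc` (the `vh₂S` of the literal of record `symTablesAn1S2 3 Lc cΛ`), at EVERY varied fine site `u₀`, in BOTH bond slots: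
# `divV (κ u ↦ symVh₂SAn1 3 Lc κ u κ′ u′) u₀ = conjV (symVhSAt ρ_c 3 Lc rfl κ′ u′) (diagK (legInd ρ_c u₀))` (scalar ONE), `ρ_c = ctr 4 Lc`
# — an1's SITE law `SymBorderWardSiteLaw.symSiteWardB` packed entrywise into an2's `MKer` language (the POINTWISE twin of an1's block-level binders
# `SymWardLettersAn1.hBord0_sym ∕ hBord0''_sym`, which SUM this identity over a block).

WHY.  leaf-03 g30's TT12 `SymCorrectorPairGaugeVertex.vertex2OfK_conj_psiKS_eq_add_contacts_of_letters` and leaf-01 g31's TT15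
`ColumnGaugeSecondOrder.vertex2OfK_coDressKBmAt_eq_add_Wmix_Wgg` take the second-order letters POINTWISE in the varied site (their weights `χ_{μ,y}(u)` ∕
`faceWt` vary inside a block, so block-summed letters do not suffice): `hL : ∀ κ′ u′ u, divV (κ u ↦ S₂ κ u κ′ u′) u = ξ₁ • conjV (T′ κ′ u′) (diagK (legInd ρ u))`,
`hR : ∀ α x u′, divV (S₂ α x) u′ = ξ₂ • conjV (T α x) (diagK (legInd ρ u′))`.  For the literal of record `S₂⁰ = n⁸•wilsonW₂ 3 ((8N²)⁻¹•wsym22 N) + cB•vh₂S`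
(TT8) the Wilson sector's pointwise letters are leaf-09's `WilsonBiStencilWardZ.divV_wilsonW₂_wsym22_eq_conjV` ∕ `WilsonBiStencilWardSocket.divV_wilsonW₂_wsym22_snd_eq_conjV`
(in the tree); THIS file supplies the border sector's: §1 first slot, §2 second slot (by `symVh₂SAn1_swap`), §3 with the literal's scalars — at lockB `cB = −Lc¹²∕4`
the partner of `cB • vh₂S` is `(Lc⁴∕2) •` the literal's border first-order member `(−Lc⁸∕2) • symVhSAt ρ_c` — the SAME scalar `ξ = Lc⁴∕2` as the first-order
letter's (`ColumnGaugeCombPartner.divV_S_zero_eq_smul_conjV_leggedBorder`) and as the Wilson sector's (`n⁸·(8N²)⁻¹·4N² = (n⁴∕2)·n⁴`), so `T = T′ = S♭`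
(`PART24-HEAD-SPEC-g24.md` §2).

HONEST DEPENDENCY (cell records, verbatim): «continuum YM on T⁴ ⇐ BetaPertH ∧ nine spine estimates (0/9 proved); BetaPertH ⇐ (D1) ∧ (D4) ∧
CAP+tail; G-an2-4 gates asym, D1 and NE2/3/4.»  HONEST FRAMING (cell contract, verbatim): «discharging `BetaPertH` makes Bałaban's UV stability
UNCONDITIONAL — a real constructive-QFT result; it is NOT the continuum limit and NOT the Clay problem.»  THIS MODULE DISCHARGES NO binder of row D1 and
NO estimate of Bałaban's: [folklore] entrywise packing (four fibre blocks, finite sums) of an1's kernel-checked site law `symSiteWardB` ([our object]s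
`symVh₂SAn1`, `symVhSAt`) BY NAME; no new table fact.  No definition, no `def … : Prop`, nothing cited, 0 sorry.  0∕4 row-D1 binders; (K) NOT closed;
(J1) ONE OPEN ROW; NOT D1, NEVER «G-an2-4 closed», NOT `BetaPertH`, NOT continuum, NOT Clay.

ABSOLUTE RULE (cell charter, verbatim): «No internally-minted statement may enter as a cited fact. Every hypothesis is either kernel-proved in this
package or a verbatim quotation of a PUBLISHED theorem with page reference. The manuscript(s) under audit are NOT citable for their own disputed
steps — they are the thing under adjudication; programme-internal (2001/route/tribunal) claims are never citable.»

Unit `b2b-balaban-beta-d1-p2` (road owner, gen 24), 2026-08-23; over an1's `SymBorderWardSiteLaw` ∕ `SymWardLettersUnpacking` ∕ `SymSecondOrderTablesAn1` and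
an2's `DiagonalContact` BY NAME; no existing file touched.
-/

noncomputable section

namespace Summit.QuantumFields.BalabanUV.Beta.D1BFx.CombBorderPairSlotLetter

open Finset
open scoped BigOperators
open Literature.MathematicalPhysics.QuantumFieldTheory.Balaban1983to89
open Literature.MathematicalPhysics.QuantumFieldTheory.Balaban1983to89.Beta
open ExpKernelCalculus (MKer)
open OneStepResolventKernel (Fib)
open KernelWard (divV)
open AffineAveraging (toSite)
open AveragingContours (blk off blk_add_off)
open AveragingContoursRooted (ctr)
open Summit.QuantumFields.BalabanUV.Beta.ChartConjugation (conjV)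
open Summit.QuantumFields.BalabanUV.Beta.BorderedHessian (diagK conjV_diagK_apply)
open Summit.QuantumFields.BalabanUV.Beta.AveragingWardRootedStencils (legInd legInd_inl legInd_inr)
open Summit.QuantumFields.BalabanUV.Beta.SymAveragingHessianCounts (symVhSAt symVhKerAt symVhSAt_symm)
open Summit.QuantumFields.BalabanUV.Beta.SymAveragingMixedJetTables (symVh2KerAt)
open Summit.QuantumFields.BalabanUV.Beta.SymSecondOrderTablesAn1 (symVh₂SAn1 symVh₂SAn1_inl_inl symVh₂SAn1_inr_inr symVh₂SAn1_antiTwin symVh₂SAn1_swap)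
open Summit.QuantumFields.BalabanUV.Beta.SymWardLettersUnpacking (symVh₂SAn1_inl_inr symVhSAt_inl_inr')
open Summit.QuantumFields.BalabanUV.Beta.SymBorderWardSiteLaw (symSiteWardB)

variable {Lc : ℕ} [NeZero Lc]

/-! ## §0 Two bookkeeping facts -/

/-- [folklore] A fine point with zero offset is its block root: `off Lc z = 0 → (Lc : ℤ) • blk Lc z = z`. -/
theorem zsmul_blk_eq_of_off_eq_zero {d : ℕ} {z : Fin d → ℤ} (hz : off Lc z = 0) : (Lc : ℤ) • blk Lc z = z := by
  have h := blk_add_off (Nat.one_le_iff_ne_zero.2 (NeZero.ne Lc)) z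
  rw [hz] at h
  have h0 : toSite (0 : Fin d → ℕ) = 0 := by funext i; simp [AffineAveraging.toSite]
  rwa [h0, add_zero] at h

/-- [folklore] The fine divergence of a family of kernels, read at an entry. -/
theorem divV_apply_entry {d : ℕ} (V : Fin (d + 1) → (Fin (d + 1) → ℤ) → MKer (d + 1) (Fib d)) (u₀ x z : Fin (d + 1) → ℤ) (a b : Fib d) :
    divV V u₀ x z a b = ∑ κ : Fin (d + 1), (V κ (u₀ - B6BondElimination.unitVec κ) x z a b - V κ u₀ x z a b) := by
  simp only [KernelWard.divV, Finset.sum_apply, Pi.sub_apply]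

/-! ## §1 The first bond slot -/

/-- **THE POINTWISE FIRST-SLOT LETTER OF THE RECORD's BORDER BI-TABLE** [our object, from an1's site law]: for every second bond `(κ′, u′)` and every varied
fine site `u₀`, `divV (κ u ↦ symVh₂SAn1 3 Lc κ u κ′ u′) u₀ = conjV (symVhSAt ρ_c 3 Lc rfl κ′ u′) (diagK (legInd ρ_c u₀))`, `ρ_c = ctr 4 Lc` — scalar ONE
(the `½`'s of the symmetrised table are inside `symVh₂SAn1`).  Four fibre blocks: ff ∕ mm vanish on both sides; fm is `symSiteWardB` at the block root
`z = Lc • blk z`; mf is its anti-twin mirror (`symVh₂SAn1_antiTwin`, `symVhSAt_symm`). -/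
theorem divV_symVh₂SAn1_fst_eq_conjV (κ' : Fin 4) (u' u₀ : Fin 4 → ℤ) :
    divV (fun κ u => symVh₂SAn1 3 Lc κ u κ' u') u₀ = conjV (symVhSAt (ctr 4 Lc) 3 Lc rfl κ' u') (diagK (legInd (ctr 4 Lc) u₀)) := by
  funext x z a b
  rw [divV_apply_entry, conjV_diagK_apply]
  rcases a with β | m₀ <;> rcases b with β' | m
  · -- (inl, inl): both sides vanish
    simp only [symVh₂SAn1_inl_inl, sub_self, Finset.sum_const_zero]
    unfold symVhSAt; rw [AveragingHessianKernels.packVH_inl_inl]; ring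
  · -- (inl β, inr m): the site law at the block root of `z`
    simp only [symVh₂SAn1_inl_inr, symVhSAt_inl_inr', legInd_inl, legInd_inr]
    by_cases hz : off Lc z = 0
    · simp only [hz, if_true]
      have h := symSiteWardB (Lc := Lc) u₀ m (blk Lc z) β x κ' u'
      rw [zsmul_blk_eq_of_off_eq_zero hz] at h
      rw [h]
      have e1 : (if u₀ = z + ctr 4 Lc then (1 : ℝ) else 0) = (if z + ctr 4 Lc = u₀ then (1 : ℝ) else 0) := by
        simp only [eq_comm]
      have e2 : (if u₀ = x then (1 : ℝ) else 0) = (if x = u₀ then (1 : ℝ) else 0) := by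
        simp only [eq_comm]
      rw [e1, e2]
    · simp only [hz, if_false, sub_self, Finset.sum_const_zero, zero_mul]
  · -- (inr m₀, inl β'): the anti-twin mirror at `(z, x)`
    simp only [symVh₂SAn1_antiTwin, symVh₂SAn1_inl_inr, legInd_inl, legInd_inr]
    rw [symVhSAt_symm, symVhSAt_inl_inr']
    by_cases hx : off Lc x = 0
    · simp only [hx, if_true]
      have h := symSiteWardB (Lc := Lc) u₀ m₀ (blk Lc x) β' z κ' u'
      rw [zsmul_blk_eq_of_off_eq_zero hx] at h
      have e1 : (if u₀ = x + ctr 4 Lc then (1 : ℝ) else 0) = (if x + ctr 4 Lc = u₀ then (1 : ℝ) else 0) := by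
        simp only [eq_comm]
      have e2 : (if u₀ = z then (1 : ℝ) else 0) = (if z = u₀ then (1 : ℝ) else 0) := by
        simp only [eq_comm]
      rw [e1, e2] at h
      simp only [Finset.sum_sub_distrib, Finset.sum_neg_distrib] at h ⊢
      linear_combination -h
    · simp only [hx, if_false, neg_zero, sub_self, Finset.sum_const_zero, zero_mul]
  · -- (inr, inr): both sides vanish
    simp only [symVh₂SAn1_inr_inr, sub_self, Finset.sum_const_zero]
    unfold symVhSAt; rw [AveragingHessianKernels.packVH_inr_inr]; ring

/-! ## §2 The second bond slot (the table is symmetric in its two bonds) -/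

/-- **THE POINTWISE SECOND-SLOT LETTER** [our object]: `divV (symVh₂SAn1 3 Lc κ u) u₀ = conjV (symVhSAt ρ_c 3 Lc rfl κ u) (diagK (legInd ρ_c u₀))`
(`symVh₂SAn1_swap` + §1). -/
theorem divV_symVh₂SAn1_snd_eq_conjV (κ : Fin 4) (u u₀ : Fin 4 → ℤ) :
    divV (symVh₂SAn1 3 Lc κ u) u₀ = conjV (symVhSAt (ctr 4 Lc) 3 Lc rfl κ u) (diagK (legInd (ctr 4 Lc) u₀)) := by
  have e : symVh₂SAn1 3 Lc κ u = fun κ' u' => symVh₂SAn1 3 Lc κ' u' κ u := by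
    funext κ' u'
    exact symVh₂SAn1_swap Lc κ u κ' u'
  rw [e]
  exact divV_symVh₂SAn1_fst_eq_conjV κ u u₀

/-! ## §3 With the literal's scalars: lockB `cB = −Lc¹²∕4`, border first-order member `(−Lc⁸∕2) • symVhSAt ρ_c`, common scalar `ξ = Lc⁴∕2` -/

/-- [folklore] Scalars: `a • divV (κ u ↦ F κ u) = divV (κ u ↦ a • F κ u)` (entrywise, finite sums). -/
theorem divV_smul_family {d : ℕ} (a : ℝ) (F : Fin (d + 1) → (Fin (d + 1) → ℤ) → MKer (d + 1) (Fib d)) (u₀ : Fin (d + 1) → ℤ) :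
    divV (fun κ u => a • F κ u) u₀ = a • divV F u₀ := by
  funext x z c e
  rw [divV_apply_entry, Pi.smul_apply, Pi.smul_apply, Pi.smul_apply, Pi.smul_apply, smul_eq_mul, divV_apply_entry, Finset.mul_sum]
  refine Finset.sum_congr rfl fun κ _ => ?_
  simp only [Pi.smul_apply, smul_eq_mul]
  ring

/-- **`hL` FOR THE BORDER SECTOR OF THE LITERAL OF RECORD** [our object]: at lockB, for every second bond and varied site,
`divV (κ u ↦ (−Lc¹²∕4) • symVh₂SAn1 3 Lc κ u κ′ u′) u₀ = (Lc⁴∕2) • conjV ((−Lc⁸∕2) • symVhSAt ρ_c 3 Lc rfl κ′ u′) (diagK (legInd ρ_c u₀))` — TT12's `hL` for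
`S₂ :=` the border part of `S₂⁰`, `T′ :=` the border part of `S♭`, `ξ₁ = Lc⁴∕2`. -/
theorem hL_border (κ' : Fin 4) (u' u₀ : Fin 4 → ℤ) :
    divV (fun κ u => (-((Lc : ℝ) ^ 12 / 4)) • symVh₂SAn1 3 Lc κ u κ' u') u₀
      = ((Lc : ℝ) ^ 4 / 2) • conjV ((-((Lc : ℝ) ^ 8 / 2)) • symVhSAt (ctr 4 Lc) 3 Lc rfl κ' u') (diagK (legInd (ctr 4 Lc) u₀)) := by
  rw [divV_smul_family, divV_symVh₂SAn1_fst_eq_conjV]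
  funext x z c e
  simp only [Pi.smul_apply, smul_eq_mul, conjV_diagK_apply]
  ring

/-- **`hR` FOR THE BORDER SECTOR OF THE LITERAL OF RECORD** [our object]: `divV ((−Lc¹²∕4) • symVh₂SAn1 3 Lc κ u) u₀ = (Lc⁴∕2) • conjV ((−Lc⁸∕2) • symVhSAt ρ_c 3 Lc rfl κ u) (diagK (legInd ρ_c u₀))`
— TT12's `hR`, `ξ₂ = Lc⁴∕2`. -/
theorem hR_border (κ : Fin 4) (u u₀ : Fin 4 → ℤ) :
    divV ((-((Lc : ℝ) ^ 12 / 4)) • symVh₂SAn1 3 Lc κ u) u₀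
      = ((Lc : ℝ) ^ 4 / 2) • conjV ((-((Lc : ℝ) ^ 8 / 2)) • symVhSAt (ctr 4 Lc) 3 Lc rfl κ u) (diagK (legInd (ctr 4 Lc) u₀)) := by
  rw [show ((-((Lc : ℝ) ^ 12 / 4)) • symVh₂SAn1 3 Lc κ u) = fun κ' u' => (-((Lc : ℝ) ^ 12 / 4)) • symVh₂SAn1 3 Lc κ u κ' u' from rfl,
    divV_smul_family, divV_symVh₂SAn1_snd_eq_conjV]
  funext x z c e
  simp only [Pi.smul_apply, smul_eq_mul, conjV_diagK_apply]
  ring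

end Summit.QuantumFields.BalabanUV.Beta.D1BFx.CombBorderPairSlotLetter

end
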